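import Summits.AtomisticToContinuum.FouriersLaw.Theorems.OddSectorIrreversibilitySubBallisticWindowGibbsPoincare
import Summits.AtomisticToContinuum.FouriersLaw.Theorems.OddSectorIrreversibilitySubBallisticWindowGibbsMoments
import Summits.AtomisticToContinuum.FouriersLaw.Theorems.OddSectorIrreversibilitySubBallisticWindowRampCorrector
import HarnessLib

/-!
# Crux `ExtensiveSnapshotIrreversibility` (stmt-AtomisticToContinuum-9121), line `clausius-budget-sound-window`:
stub S4f `stub_extensiveFisherInformation` — registered sub-goal `gibbs_hamiltonian_variance_le`

The energy variance (heat capacity) of the pinned anharmonic chain `P = pinnedChain ω₂ lam β γ`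
(`ω₂ > 0`, `lam, β ≥ 0`, any `γ`) in its Gibbs state `μ_T = P.gibbsMeasure N T` (`T > 0`) is EXTENSIVE,
uniformly in the length `N`:

  `∃ C, ∀ N, H² ∈ L¹(μ_T) ∧ ∫ (H − ∫ H dμ_T)² dμ_T ≤ C · N`.

Proof (all ingredients PROVED in the tree):
* the `N`-uniform Poincaré inequality for the Gibbs weight `e^{-H/T} dq dp`, constant `T / min(ω₂,1)`
  (`SubBallisticWindow.GibbsPoincare.stub_gibbsPoincare`: Brascamp–Lieb 1976 Thm 4.1 for the
  `min(ω₂,1)`-uniformly convex `H`, transported from `EuclideanSpace ℝ (Fin (N+N))`);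
* the `N`-uniform single-coordinate moments it implies (`SubBallisticWindow.GibbsMoments.stub_gibbsMoments`:
  `∫ q_i², ∫ q_i⁶, ∫ p_i² ≤ D·Z`);
* the Dirichlet form of `H`: `H` is the weighted site energy `W_w` with `w ≡ 1`
  (`hamiltonian_eq_weightedEnergy`), and the pointwise bound
  `|∇W_w|² ≲ ∑_i w_i² (q_i² + q_i⁶ + p_i²) + bond terms` (`SubBallisticWindow.RampCorrector.gradSq_le`)
  gives `∫ |∇H|² e^{-H/T} ≤ K · N · Z` (`gradient_bound_weights`, adapted from
  `RampCorrector.gradient_bound` with the support hypothesis on the weights dropped);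
* normalisation `μ_T = Z⁻¹ e^{-H/T} dq dp`.
The constant is `C = (T / min(ω₂,1)) · ((6ω₂² + 6lam² + 1) + 4(12 + 192β²)) · 3D`.
No new definitions, no named facts.
-/

noncomputable section

namespace Summit.AtomisticToContinuum.FouriersLaw.Theorems.ExtensiveSnapshotIrreversibility.ClausiusBudget

open MeasureTheory Filter
open scoped ENNReal NNReal
open Literature.MathematicalPhysics.KineticTheory.HeatConduction
open Summit.AtomisticToContinuum.FouriersLaw.Theorems.SubBallisticWindow.Negative.ClosedFlow
open Summit.AtomisticToContinuum.FouriersLaw.Theorems.OddSectorWitness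
open Summit.AtomisticToContinuum.FouriersLaw.Theorems.LightConeBondHeat
open Summit.AtomisticToContinuum.FouriersLaw.Theorems.SubBallisticWindow.RampCorrector

namespace GibbsEnergyVariance

/-! ## The Hamiltonian as a weighted site energy, and its Dirichlet form -/

/-- The Hamiltonian is the weighted site energy with all weights equal to `1`:
`H = ∑_k (p_k²/2 + U(q_k)) + ∑_{l = k+1} V(q_l − q_k) = W_1`. [folklore] -/
theorem hamiltonian_eq_weightedEnergy (P : OscillatorChain) (N : ℕ) :
    P.hamiltonian N = weightedEnergy P (fun _ => (1 : ℝ)) N := by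
  funext x
  have h2 : ((1 : ℝ) + 1) / 2 = 1 := by norm_num
  simp only [OscillatorChain.hamiltonian, weightedEnergy, one_mul, h2]

/-- `∑_{i<N} w_i² ≤ L² N` for weights bounded by `L`. [folklore] -/
theorem sum_sq_le_card {N : ℕ} {w : ℕ → ℝ} {L : ℝ} (hw : ∀ k, |w k| ≤ L) :
    ∑ i : Fin N, (w i.val) ^ 2 ≤ L ^ 2 * (N : ℝ) := by
  calc ∑ i : Fin N, (w i.val) ^ 2 ≤ ∑ _i : Fin N, L ^ 2 :=
        Finset.sum_le_sum fun i _ => by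
          rw [← sq_abs]
          exact pow_le_pow_left₀ (abs_nonneg _) (hw _) 2
    _ = L ^ 2 * (N : ℝ) := by
        rw [Finset.sum_const, Finset.card_univ, Fintype.card_fin, nsmul_eq_mul, mul_comm]

section Estimates

variable {ω₂ lam β : ℝ} {N : ℕ}

/-- **Dirichlet-form bound for bounded weights (no support hypothesis).** For weights `|w_k| ≤ L`,
`|∇W_w|² ∈ L¹(μ)` and `∫ |∇W_w|² dμ ≤ C_W · 3D · L² N · Z` for the Gibbs weight `μ = e^{-H/T} dq dp`,
`D Z` a common bound of the per-site moments `∫ q_i², ∫ q_i⁶, ∫ p_i²`. [folklore] -/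
theorem gradient_bound_weights (hω : 0 < ω₂) (hl : 0 ≤ lam) (hβ : 0 ≤ β) (γ : ℝ) {T : ℝ}
    (hT : 0 < T) {w : ℕ → ℝ} {L : ℝ} (hw : ∀ k, |w k| ≤ L) {D Z : ℝ} (hD : 0 ≤ D) (hZ : 0 ≤ Z)
    (hmo : ∀ i : Fin N, ∫ x, x.1 i ^ 2 ∂(gibbsWeight ω₂ lam β γ N T) ≤ D * Z ∧
      ∫ x, x.1 i ^ 6 ∂(gibbsWeight ω₂ lam β γ N T) ≤ D * Z ∧
      ∫ x, x.2 i ^ 2 ∂(gibbsWeight ω₂ lam β γ N T) ≤ D * Z) :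
    Integrable (fun x => ∑ i : Fin N, ((partialQ i (weightedEnergy (pinnedChain ω₂ lam β γ) w N) x) ^ 2 +
        (partialP i (weightedEnergy (pinnedChain ω₂ lam β γ) w N) x) ^ 2)) (gibbsWeight ω₂ lam β γ N T) ∧
    ∫ x, (∑ i : Fin N, ((partialQ i (weightedEnergy (pinnedChain ω₂ lam β γ) w N) x) ^ 2 +
        (partialP i (weightedEnergy (pinnedChain ω₂ lam β γ) w N) x) ^ 2)) ∂(gibbsWeight ω₂ lam β γ N T) ≤
      ((6 * ω₂ ^ 2 + 6 * lam ^ 2 + 1) + 4 * (12 + 192 * β ^ 2)) * (3 * D) * (L ^ 2 * (N : ℝ)) * Z := by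
  -- adapted from `SubBallisticWindow.RampCorrector.gradient_bound` (…SubBallisticWindowRampCorrector.lean):
  -- the support hypothesis on `w` is replaced by the crude count `∑_{i<N} w_i² ≤ L² N`.
  set μ := gibbsWeight ω₂ lam β γ N T
  set G := weightedEnergy (pinnedChain ω₂ lam β γ) w N with hG
  set g : PhaseSpace N → ℝ := fun x => ∑ i : Fin N, ((partialQ i G x) ^ 2 + (partialP i G x) ^ 2) with hg
  set m : Fin N → PhaseSpace N → ℝ := fun i x => x.1 i ^ 2 + x.1 i ^ 6 + x.2 i ^ 2 with hm
  set KA : ℝ := 6 * ω₂ ^ 2 + 6 * lam ^ 2 + 1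
  set KB : ℝ := 12 + 192 * β ^ 2
  have hG2 : ContDiff ℝ 2 G := contDiff_weightedEnergy _ (pinnedChain_contDiff_U ω₂ lam β γ)
    (pinnedChain_contDiff_V ω₂ lam β γ) w N
  have hmI : ∀ i, Integrable (m i) μ ∧ ∫ x, m i x ∂μ ≤ 3 * D * Z := fun i => by
    obtain ⟨h2, h6, hp⟩ := integrable_monomials hω hl hβ γ hT i
    refine ⟨(h2.fun_add h6).fun_add hp, ?_⟩
    simp only [hm]
    rw [integral_add (h2.fun_add h6) hp, integral_add h2 h6]
    linarith [(hmo i).1, (hmo i).2.1, (hmo i).2.2]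
  have hR1 : Integrable (fun x => ∑ i : Fin N, (w i.val) ^ 2 * m i x) μ :=
    integrable_finsetSum _ fun i _ => (hmI i).1.const_mul _
  have hR2 : Integrable (fun x => ∑ k : Fin N, ∑ l : Fin N,
      (if l.val = k.val + 1 then (w l.val) ^ 2 + (w k.val) ^ 2 else 0) * (m k x + m l x)) μ :=
    integrable_finsetSum _ fun k _ => integrable_finsetSum _ fun l _ =>
      ((hmI k).1.fun_add (hmI l).1).const_mul _
  have hpt : ∀ x, g x ≤ KA * (∑ i : Fin N, (w i.val) ^ 2 * m i x) +
      KB * ∑ k : Fin N, ∑ l : Fin N,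
        (if l.val = k.val + 1 then (w l.val) ^ 2 + (w k.val) ^ 2 else 0) * (m k x + m l x) := by
    intro x
    simp only [hg, hG, hm, partialQ_weightedEnergy _
      ((pinnedChain_contDiff_U ω₂ lam β γ (n := 1)).differentiable one_ne_zero)
      ((pinnedChain_contDiff_V ω₂ lam β γ (n := 1)).differentiable one_ne_zero), partialP_weightedEnergy]
    exact gradSq_le γ w x
  have hRint := (hR1.const_mul KA).fun_add (hR2.const_mul KB)
  have hint : Integrable g μ := hRint.mono'
    (continuous_finsetSum _ fun i _ => ((continuous_partialQ hG2 two_ne_zero i).pow 2).add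
      ((continuous_partialP hG2 two_ne_zero i).pow 2)).aestronglyMeasurable
    (Eventually.of_forall fun x => by
      rw [Real.norm_eq_abs, abs_of_nonneg (Finset.sum_nonneg fun i _ => by positivity)]
      exact hpt x)
  refine ⟨hint, (integral_mono hint hRint hpt).trans ?_⟩
  rw [integral_add (hR1.const_mul KA) (hR2.const_mul KB), integral_const_mul, integral_const_mul,
    integral_finsetSum _ fun i _ => (hmI i).1.const_mul _,
    integral_finsetSum _ fun k _ => integrable_finsetSum _ fun l _ =>
      ((hmI k).1.fun_add (hmI l).1).const_mul _]
  have I1 : ∑ i : Fin N, ∫ x, (w i.val) ^ 2 * m i x ∂μ ≤ (L ^ 2 * (N : ℝ)) * (3 * D * Z) :=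
    calc ∑ i : Fin N, ∫ x, (w i.val) ^ 2 * m i x ∂μ ≤ ∑ i : Fin N, (w i.val) ^ 2 * (3 * D * Z) :=
          Finset.sum_le_sum fun i _ => by
            rw [integral_const_mul]
            exact mul_le_mul_of_nonneg_left (hmI i).2 (sq_nonneg _)
      _ ≤ _ := by
          rw [← Finset.sum_mul]
          exact mul_le_mul_of_nonneg_right (sum_sq_le_card hw) (by positivity)
  have I2 : ∑ k : Fin N, ∫ x, ∑ l : Fin N,
      (if l.val = k.val + 1 then (w l.val) ^ 2 + (w k.val) ^ 2 else 0) * (m k x + m l x) ∂μ ≤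
      (2 * (L ^ 2 * (N : ℝ))) * (2 * (3 * D * Z)) :=
    calc _ ≤ ∑ k : Fin N, ∑ l : Fin N,
          (if l.val = k.val + 1 then (w l.val) ^ 2 + (w k.val) ^ 2 else 0) * (2 * (3 * D * Z)) := by
          refine Finset.sum_le_sum fun k _ => ?_
          rw [integral_finsetSum _ fun l _ => ((hmI k).1.fun_add (hmI l).1).const_mul _]
          refine Finset.sum_le_sum fun l _ => ?_
          rw [integral_const_mul, integral_add (hmI k).1 (hmI l).1]
          exact mul_le_mul_of_nonneg_left (by linarith [(hmI k).2, (hmI l).2])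
            (by split_ifs <;> positivity)
      _ = (∑ k : Fin N, ∑ l : Fin N,
            (if l.val = k.val + 1 then (w l.val) ^ 2 + (w k.val) ^ 2 else 0)) * (2 * (3 * D * Z)) := by
          rw [Finset.sum_mul]
          exact Finset.sum_congr rfl fun k _ => (Finset.sum_mul _ _ _).symm
      _ ≤ _ := mul_le_mul_of_nonneg_right ((sum_bond_ends_le N (f := fun i : Fin N => (w i.val) ^ 2)
          fun i => sq_nonneg _).trans (mul_le_mul_of_nonneg_left (sum_sq_le_card hw) (by norm_num)))
          (by positivity)
  nlinarith [mul_le_mul_of_nonneg_left I1 (by positivity : (0 : ℝ) ≤ KA),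
    mul_le_mul_of_nonneg_left I2 (by positivity : (0 : ℝ) ≤ KB)]

/-- **Dirichlet form of the energy**: `|∇H|² = ∑_i ((∂_{q_i}H)² + p_i²) ∈ L¹(e^{-H/T} dq dp)` and
`∫ |∇H|² e^{-H/T} ≤ C_W · 3D · N · Z`, given per-site moment bounds `∫ q_i², ∫ q_i⁶, ∫ p_i² ≤ D Z`.
[folklore] -/
theorem gradient_bound_hamiltonian (hω : 0 < ω₂) (hl : 0 ≤ lam) (hβ : 0 ≤ β) (γ : ℝ) {T : ℝ}
    (hT : 0 < T) {D Z : ℝ} (hD : 0 ≤ D) (hZ : 0 ≤ Z)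
    (hmo : ∀ i : Fin N, ∫ x, x.1 i ^ 2 ∂(gibbsWeight ω₂ lam β γ N T) ≤ D * Z ∧
      ∫ x, x.1 i ^ 6 ∂(gibbsWeight ω₂ lam β γ N T) ≤ D * Z ∧
      ∫ x, x.2 i ^ 2 ∂(gibbsWeight ω₂ lam β γ N T) ≤ D * Z) :
    Integrable (fun x => ∑ i : Fin N, ((partialQ i ((pinnedChain ω₂ lam β γ).hamiltonian N) x) ^ 2 +
        (partialP i ((pinnedChain ω₂ lam β γ).hamiltonian N) x) ^ 2)) (gibbsWeight ω₂ lam β γ N T) ∧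
    ∫ x, (∑ i : Fin N, ((partialQ i ((pinnedChain ω₂ lam β γ).hamiltonian N) x) ^ 2 +
        (partialP i ((pinnedChain ω₂ lam β γ).hamiltonian N) x) ^ 2)) ∂(gibbsWeight ω₂ lam β γ N T) ≤
      ((6 * ω₂ ^ 2 + 6 * lam ^ 2 + 1) + 4 * (12 + 192 * β ^ 2)) * (3 * D) * (N : ℝ) * Z := by
  rw [hamiltonian_eq_weightedEnergy]
  have h := gradient_bound_weights hω hl hβ γ hT (N := N) (w := fun _ => (1 : ℝ)) (L := 1)
    (fun _ => by rw [abs_one]) hD hZ hmo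
  rw [one_pow, one_mul] at h
  exact h

end Estimates

end GibbsEnergyVariance

open GibbsEnergyVariance

/-! ## The registered sub-goal -/

/-- **Extensive energy variance of the Gibbs state** (sub-goal `gibbs_hamiltonian_variance_le` of stub
S4f `stub_extensiveFisherInformation`, line `clausius-budget-sound-window`). For the pinned anharmonic
chain `P = pinnedChain ω₂ lam β γ` (`ω₂ > 0`, `lam, β ≥ 0`, any `γ`) and `T > 0` there is `C` with, for
EVERY `N`, `H² ∈ L¹(μ_T)` and `∫ (H − ∫ H dμ_T)² dμ_T ≤ C · N` (`μ_T = P.gibbsMeasure N T`). Proof: the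
`N`-uniform Poincaré inequality for `e^{-H/T} dq dp` (Brascamp–Lieb, `stub_gibbsPoincare`), the
`N`-uniform coordinate moments (`stub_gibbsMoments`), the Dirichlet-form bound
`∫ |∇H|² e^{-H/T} ≤ K N Z` (`gradient_bound_hamiltonian`) and the normalisation `μ_T = Z⁻¹ e^{-H/T}`.
[folklore] -/
theorem gibbs_hamiltonian_variance_le :
    ∀ ω₂ lam β γ : ℝ, 0 < ω₂ → 0 ≤ lam → 0 ≤ β → ∀ T : ℝ, 0 < T → ∃ C : ℝ, ∀ N : ℕ,
      Integrable (fun x => ((pinnedChain ω₂ lam β γ).hamiltonian N x) ^ 2)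
          ((pinnedChain ω₂ lam β γ).gibbsMeasure N T) ∧
        ∫ x, ((pinnedChain ω₂ lam β γ).hamiltonian N x -
            ∫ y, (pinnedChain ω₂ lam β γ).hamiltonian N y ∂((pinnedChain ω₂ lam β γ).gibbsMeasure N T)) ^ 2
          ∂((pinnedChain ω₂ lam β γ).gibbsMeasure N T) ≤ C * N := by
  -- adapted from `LightConeBondHeat.pinnedChain_tentEnergy_variance_le` (…LightConeBondHeatTentStatics.lean)
  intro ω₂ lam β γ hω hl hβ T hT
  -- the `N`-uniform Poincaré inequality and the `N`-uniform moments it implies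
  have hP := Summit.AtomisticToContinuum.FouriersLaw.Theorems.SubBallisticWindow.GibbsPoincare.stub_gibbsPoincare
    ω₂ lam β γ hω hl hβ T hT
  obtain ⟨C₁, hC₁⟩ :=
    Summit.AtomisticToContinuum.FouriersLaw.Theorems.SubBallisticWindow.GibbsMoments.stub_gibbsMoments
      ω₂ lam β γ hω hl hβ T hT hP 1
  obtain ⟨C₃, hC₃⟩ :=
    Summit.AtomisticToContinuum.FouriersLaw.Theorems.SubBallisticWindow.GibbsMoments.stub_gibbsMoments
      ω₂ lam β γ hω hl hβ T hT hP 3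
  set D : ℝ := max (max C₁ C₃) 0 with hD
  have hD0 : 0 ≤ D := le_max_right _ _
  have hC₁D : C₁ ≤ D := (le_max_left _ _).trans (le_max_left _ _)
  have hC₃D : C₃ ≤ D := (le_max_right _ _).trans (le_max_left _ _)
  set K : ℝ := ((6 * ω₂ ^ 2 + 6 * lam ^ 2 + 1) + 4 * (12 + 192 * β ^ 2)) * (3 * D) with hK
  refine ⟨T / min ω₂ 1 * K, fun N => ?_⟩
  set P := pinnedChain ω₂ lam β γ with hPdef
  set μw : Measure (PhaseSpace N) := volume.withDensity fun x : PhaseSpace N =>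
    ENNReal.ofReal (Real.exp (-(P.hamiltonian N x) / T)) with hμw
  set Z : ℝ := ∫ x : PhaseSpace N, Real.exp (-(P.hamiltonian N x) / T) with hZ
  -- the partition function is positive
  have hρ : Integrable (fun x : PhaseSpace N => Real.exp (-(P.hamiltonian N x) / T)) :=
    pinnedChain_integrable_gibbsDensity hω hl hβ γ N hT
  have hZpos : 0 < Z := integral_exp_pos hρ
  have hH0 : ∀ x, 0 ≤ P.hamiltonian N x := fun x => pinnedChain_hamiltonian_nonneg hω.le hl hβ γ N x
  -- `N`-uniform moments of the coordinates
  have hmo : ∀ i : Fin N, ∫ x, x.1 i ^ 2 ∂μw ≤ D * Z ∧ ∫ x, x.1 i ^ 6 ∂μw ≤ D * Z ∧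
      ∫ x, x.2 i ^ 2 ∂μw ≤ D * Z := by
    intro i
    obtain ⟨h1q, h1p⟩ := hC₁ N i
    obtain ⟨h3q, -⟩ := hC₃ N i
    simp only [Nat.mul_one] at h1q h1p
    refine ⟨h1q.trans ?_, ?_, h1p.trans ?_⟩
    · exact mul_le_mul_of_nonneg_right hC₁D hZpos.le
    · have : ∫ x, x.1 i ^ 6 ∂μw = ∫ x, x.1 i ^ (2 * 3) ∂μw := by norm_num
      rw [this]
      exact h3q.trans (mul_le_mul_of_nonneg_right hC₃D hZpos.le)
    · exact mul_le_mul_of_nonneg_right hC₁D hZpos.le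
  -- the Dirichlet form of the energy
  obtain ⟨hGI, hgrad⟩ := gradient_bound_hamiltonian hω hl hβ γ hT hD0 hZpos.le hmo
  -- the Poincaré inequality for `G = H`
  have hGc1 : ContDiff ℝ 1 (P.hamiltonian N) := pinnedChain_contDiff_hamiltonian ω₂ lam β γ N (n := 1)
  have hGL2 : MemLp (P.hamiltonian N) 2 μw :=
    memLp_two_of_abs_le_pow hω hl hβ γ N hT hGc1.continuous.aestronglyMeasurable 1 1 fun x => by
      rw [pow_one, abs_of_nonneg (hH0 x)]
      linarith [hH0 x]
  have key := hP N (P.hamiltonian N) hGc1 hGL2 hGI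
  have hbound : ∫ x, (P.hamiltonian N x - (∫ y, P.hamiltonian N y ∂μw) / Z) ^ 2 ∂μw ≤
      T / min ω₂ 1 * K * N * Z := by
    have hTm : 0 ≤ T / min ω₂ 1 := div_nonneg hT.le (le_min hω.le zero_le_one)
    calc ∫ x, (P.hamiltonian N x - (∫ y, P.hamiltonian N y ∂μw) / Z) ^ 2 ∂μw
        ≤ T / min ω₂ 1 * ∫ x, (∑ i : Fin N, ((partialQ i (P.hamiltonian N) x) ^ 2 +
            (partialP i (P.hamiltonian N) x) ^ 2)) ∂μw := key
      _ ≤ T / min ω₂ 1 * (K * (N : ℝ) * Z) := mul_le_mul_of_nonneg_left hgrad hTm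
      _ = T / min ω₂ 1 * K * N * Z := by ring
  -- normalisation: `∫ g dμ_T = Z⁻¹ ∫ g dμw`
  have hnorm : ∀ g : PhaseSpace N → ℝ, ∫ x, g x ∂(P.gibbsMeasure N T) = Z⁻¹ * ∫ x, g x ∂μw := by
    intro g
    rw [P.integral_gibbsMeasure,
      Summit.AtomisticToContinuum.FouriersLaw.Theorems.SubBallisticWindow.GibbsPoincare.integral_gibbsWeight_eq]
    rfl
  have hmean : ∫ y, P.hamiltonian N y ∂(P.gibbsMeasure N T) = (∫ y, P.hamiltonian N y ∂μw) / Z := by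
    rw [hnorm, div_eq_inv_mul]
  refine ⟨?_, ?_⟩
  · -- `H² ∈ L¹(μ_T)`: `H² ≤ (1 + H)²` and `(1 + H)² e^{-H/T} ∈ L¹`
    exact P.integrable_gibbsMeasure (pinnedChain_integrable_mul_gibbsDensity_of_le_pow hω hl hβ γ N hT 2
      ((pinnedChain_continuous_hamiltonian ω₂ lam β γ N).pow 2) (C := 1) fun x => by
        rw [abs_of_nonneg (sq_nonneg _), one_mul]
        nlinarith [hH0 x])
  · rw [hmean, hnorm, inv_mul_le_iff₀ hZpos]
    calc ∫ x, (P.hamiltonian N x - (∫ y, P.hamiltonian N y ∂μw) / Z) ^ 2 ∂μw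
        ≤ T / min ω₂ 1 * K * N * Z := hbound
      _ = Z * (T / min ω₂ 1 * K * N) := by ring

end Summit.AtomisticToContinuum.FouriersLaw.Theorems.ExtensiveSnapshotIrreversibility.ClausiusBudget

end
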